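import Literature.AlgebraicTopology.Homotopy.ManifoldStronglyLocallyContractible
import HarnessLib

/-!
# Finite products of manifolds — tori `(ℝ/pℤ)^ι`, punctured tori — are strongly locally contractible

Topic `Literature/AlgebraicTopology/Homotopy`, sequel of `ManifoldStronglyLocallyContractible.lean`
(abc-iut cell, campaign-L R1 (3ε): the hypothesis `StronglyLocallyContractibleSpace` of the Galois
correspondence `Cov(Fin).galoisCorrespondence` for the punctured torus `(ℝ/ℤ)² ∖ {x₀}`):

* `stronglyLocallyContractibleSpace_pi_of_chartedSpace_normedSpace` — a finite product of spaces
  charted over real normed spaces (Mathlib's `piChartedSpace` over `ModelPi`);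
* **`stronglyLocallyContractibleSpace_pi_circle`**, **`stronglyLocallyContractibleSpace_pi_addCircle`**
  — the tori `Circle^ι`, `(AddCircle p)^ι` (`ι` finite, `p ≠ 0`);
* **`stronglyLocallyContractibleSpace_isOpen_pi_addCircle`**,
  **`stronglyLocallyContractibleSpace_compl_finite_pi_addCircle`**,
  **`stronglyLocallyContractibleSpace_compl_singleton_pi_addCircle`** — open subsets, finitely
  punctured and once-punctured tori.

Everything is proved, stated as `theorem`s (no global instances; use `haveI`).

## References

* A. Hatcher, *Algebraic Topology*, CUP (2002), Appendix, Cor. A.9 (proof: "Manifolds are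
  locally contractible"). [HatcherAT2002]
-/

noncomputable section

open Set

namespace Literature.AlgebraicTopology.Homotopy

/-- **A finite product of spaces charted over real normed spaces is strongly locally contractible**
(it is charted over the product model `ModelPi`, a real normed space). [cite: HatcherAT2002, Cor. A.9 (proof)] -/
theorem stronglyLocallyContractibleSpace_pi_of_chartedSpace_normedSpace {ι : Type*} [Fintype ι]
    (H : ι → Type*) [∀ i, NormedAddCommGroup (H i)] [∀ i, NormedSpace ℝ (H i)] (M : ι → Type*)
    [∀ i, TopologicalSpace (M i)] [∀ i, ChartedSpace (H i) (M i)] :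
    StronglyLocallyContractibleSpace (∀ i, M i) := by
  haveI : StronglyLocallyContractibleSpace (ModelPi H) :=
    stronglyLocallyContractibleSpace_of_normedSpace (∀ i, H i)
  exact ChartedSpace.stronglyLocallyContractibleSpace (ModelPi H) (∀ i, M i)

/-- **The torus `Circle^ι` (`ι` finite) is strongly locally contractible.** [cite: HatcherAT2002, Cor. A.9 (proof)] -/
theorem stronglyLocallyContractibleSpace_pi_circle (ι : Type*) [Fintype ι] :
    StronglyLocallyContractibleSpace (ι → Circle) :=
  stronglyLocallyContractibleSpace_pi_of_chartedSpace_normedSpace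
    (fun _ : ι ↦ EuclideanSpace ℝ (Fin 1)) (fun _ ↦ Circle)

/-- **The torus `(ℝ/pℤ)^ι = (AddCircle p)^ι` (`ι` finite, `p ≠ 0`) is strongly locally contractible**
(homeomorphic to `Circle^ι` factorwise, Mathlib's `AddCircle.homeomorphCircle`).
[cite: HatcherAT2002, Cor. A.9 (proof)] -/
theorem stronglyLocallyContractibleSpace_pi_addCircle (ι : Type*) [Finite ι] {p : ℝ} (hp : p ≠ 0) :
    StronglyLocallyContractibleSpace (ι → AddCircle p) := by
  haveI := Fintype.ofFinite ι
  haveI := stronglyLocallyContractibleSpace_pi_circle ι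
  exact (Homeomorph.piCongrRight fun _ : ι ↦ AddCircle.homeomorphCircle hp).isOpenEmbedding
    |>.stronglyLocallyContractibleSpace

/-- Open subsets of the torus `(AddCircle p)^ι` are strongly locally contractible.
[cite: HatcherAT2002, Cor. A.9 (proof)] -/
theorem stronglyLocallyContractibleSpace_isOpen_pi_addCircle {ι : Type*} [Finite ι] {p : ℝ}
    (hp : p ≠ 0) {U : Set (ι → AddCircle p)} (hU : IsOpen U) :
    StronglyLocallyContractibleSpace ↥U := by
  haveI := stronglyLocallyContractibleSpace_pi_addCircle ι hp
  exact hU.stronglyLocallyContractibleSpace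

/-- **Finitely punctured tori `(AddCircle p)^ι ∖ F` are strongly locally contractible.**
[cite: HatcherAT2002, Cor. A.9 (proof)] -/
theorem stronglyLocallyContractibleSpace_compl_finite_pi_addCircle {ι : Type*} [Finite ι] {p : ℝ}
    (hp : p ≠ 0) {F : Set (ι → AddCircle p)} (hF : F.Finite) :
    StronglyLocallyContractibleSpace ↥Fᶜ :=
  stronglyLocallyContractibleSpace_isOpen_pi_addCircle hp hF.isClosed.isOpen_compl

/-- **The once-punctured torus `(AddCircle p)^ι ∖ {x₀}` is strongly locally contractible.**
[cite: HatcherAT2002, Cor. A.9 (proof)] -/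
theorem stronglyLocallyContractibleSpace_compl_singleton_pi_addCircle {ι : Type*} [Finite ι]
    {p : ℝ} (hp : p ≠ 0) (x₀ : ι → AddCircle p) :
    StronglyLocallyContractibleSpace ↥({x₀}ᶜ : Set (ι → AddCircle p)) :=
  stronglyLocallyContractibleSpace_compl_finite_pi_addCircle hp (finite_singleton x₀)

end Literature.AlgebraicTopology.Homotopy

end
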